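import Summits.QuantumFields.BalabanUV.T4Continuum.Support.NE7ApeCurvedRepRoadBGradientMFourTerm
import Summits.QuantumFields.BalabanUV.T4Continuum.Support.NE3FluxGradientDictionary
import Summits.QuantumFields.BalabanUV.T4Continuum.Support.MinimalActionClassSix
import HarnessLib

/-!
# NE7ApeCurvedRepRoadBGradientClassFourTerm — O2 RE-THREAD, FILE 12 = THE NEW END OF RECORD ON THE FOUR-TERM LETTER: `NE7ApeCurvedRepRoadBGradientClassH` (p586320, the g80 END:
# the curved (APE) with a datum on road (B) from the CLASS DATA of `W` and `U` — plaquette radii, flux-gradient radii — plus E′'s regime, the regime lines and the slice-solver letter)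
# RE-CUT on F163: `(S, hS, hG)` ↦ the FOUR-TERM letter `h4` (F152's shape: `K_G g + K_X R + K_D‖covDiv W (X + gaugeDir W σ)‖ + K_Ξ‖σ‖`) and ONE displayed kinematic letter
# `hDivCorr` (the covariant divergence of road (B)'s pointing correction on the same-top structured fields, `≤ d_C`); conclusion: the g80 radius `+ K_D·(d_C + (b₀ + 3c_RE b₀) + 2d·a_N)
# + K_Ξ·2θ_u`.  THE CURVED (APE) WITH A DATUM ON ROAD (B) NOW READS: E′ regime + class data + regime lines + (L1)′ names + the FOUR-TERM letter + `hDivCorr` (file 94 of the curved (APE), F164)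

Cell `pub-balaban`, rung (B)+1 sub-cell t4, lineage `b2b-balaban-t4-ne7-p1` (CRUX PROVER NE7 #1 = OWNER of row NE7), generation 82; memo
`t4/b2b-balaban-t4-ne7-p1-g82/LOCALISATION-ROAD.md` §2 (O2).  Text-substitution twin of `NE7ApeCurvedRepRoadBGradientClassH` (gen 80) over `NE7ApeCurvedRepRoadBGradientMFourTerm`; every supplier BY NAME as there.
WHY.  This closes gen 82's O2 re-thread (F153 root, F154–F163 links): the END of record for the successor's analytic programme (memo packagings P2∕P3) consumes exactly the
four-term letter the transfer `hard ⟸ soft` produces (F151's algebra), with the END's known gauge part priced by `K_Ξ·2θ_u` (`θ_u ∝ b₀`) and the divergence datum split into E′'s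
`b₀ + 3c_RE b₀`, the normal lift's crude `2d·a_N` (to be sharpened, memo O2(ii)) and the displayed `d_C` (to be priced bulk∕face, memo O2).  The comb∕source ENDs (F145∕F148) stay
as the sockets for a solver one-term on the comb slice by fiat.
WHAT ([folklore]; 0 def, 0 sorry).  **`smallField_of_tanCritical_roadB_gradientClass_fourTerm`**.
HONEST FRAMING (page 1): composition over DISPLAYED letters (four-term letter, `hDivCorr`) and PROVED suppliers; the crude `2d·a_N` is kinematics, not a claim that it closes; nothing
of Bałaban's asserted; (APE) on curved data NOT proved; NOT ONE-STEP, NOT NE7; spine 0∕9; finite T⁴ rung (B)+1 — NOT infinite volume, NOT mass gap, NOT `BetaPertH`, NOT Clay.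
Continuum YM on T⁴ ⇐ BetaPertH ∧ nine spine estimates (0/9 proved); BetaPertH ⇐ (D1) ∧ (D4) ∧ CAP+tail; G-an2-4 gates asym, D1 and NE2/3/4.
-/

set_option autoImplicit false

open scoped BigOperators Matrix Matrix.Norms.L2Operator
open NormedSpace Finset

namespace Summit.QuantumFields.BalabanUV.T4Continuum.NE7ApeCurvedRepRoadBGradientClassFourTerm

open Literature.MathematicalPhysics.QuantumFieldTheory.Balaban1983to89
open B7Prop1Explicit B7Prop2Explicit MatrixLog UnitaryModel
open T4AveragingDeficitWall (Ad IsUnitaryCfg IsSkewDir SmallField vary curlAt dirL1)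
open T4AveragingDeficitWallBoundary (IsPeriodicCfg periodBox)
open AveragingDeficitPeriodicCounting (IsPeriodicDir)
open AveragingDeficitTwoLevelPrep (twoLevelSmall)
open AveragingDeficitMultiLevelPrep (cavgIter LevelSmall)
open MinimalActionLevels (perWin)
open BlockAverageVaryHolo (nbRad)
open BlockAveragePushDirGauge (gaugeDir)
open NE3HessForm (hess dAction)
open NE3TangentCovariantTower (dirIter)
open NE3EnergyShapes (IsUnitarySite IsPeriodicSite)
open NE3CovariantWeitzenbock (covDiv)
open NE3RightInverseSupLetters (frameC supC corrC)
open NE3QbarIterCovLiftPrep (cruxC)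
open NE3RightInverseSolveLetters (thetaLoc)
open NE3HatInvCurlLetters (curl1C)
open BlockAverageVaryDisc (rho0)
open NE3LinearisedAverageSup (curvSum)
open NE3FluxGradientDictionary (norm_Ad_hol_sub_hol_le_of_fluxGrad)
open MinimalActionClassSix (norm_covDiv_le_of_covGrad)
open NE7ApeCurvedRepRoadBGradientMFourTerm (smallField_of_tanCritical_roadB_gradientM_fourTerm)

open NE3.PairLandauB8 (IsLandauB8)

noncomputable section

variable {d : ℕ} {n : Type*} [Fintype n] [DecidableEq n]

/-- **THE CURVED (APE) WITH A DATUM FROM THE CLASS DATA + THE FOUR-TERM SLICE-SOLVER LETTER + THE POINTING-CORRECTION DIVERGENCE LETTER** —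
`NE7ApeCurvedRepRoadBGradientClassH.smallField_of_tanCritical_roadB_gradientClass` with `(S, hS, hG)` ↦ (`hDivCorr`, `h4`); conclusion = the g80 radius
`+ K_D·(d_C + (b₀ + 3c_RE b₀) + 2d·a_N) + K_Ξ·2θ_u`. [folklore] -/
theorem smallField_of_tanCritical_roadB_gradientClass_fourTerm [Nonempty n] (hd : 2 ≤ d) {L N : ℕ} [NeZero N] (hL : 2 ≤ L) (j : ℕ)
    -- the background
    {W : Site d → Fin d → (Matrix n n ℂ)ˣ} {x : ℝ} (hWu : IsUnitaryCfg W) (hWP : IsPeriodicCfg W ((N * L ^ (j + 1) : ℕ) : ℤ))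
    (hx : 0 ≤ x) (hs : LevelSmall d L j x) (hWx : SmallField W x)
    -- the sup radius of the representative and the regime at `x′ = x + 4(e^{α₀} − 1)`
    {α₀ : ℝ} (hα0 : 0 ≤ α₀) (hs' : LevelSmall d L j (x + 4 * (Real.exp α₀ - 1)))
    (hθ : cruxC d L * (((L : ℝ) ^ (j + 1)) ^ 2 * (x + 4 * (Real.exp α₀ - 1))) < 1)
    (hθl : thetaLoc d L * (((L : ℝ) ^ (j + 1)) ^ 2 * (x + 4 * (Real.exp α₀ - 1))) < 1)
    (hε : ((L : ℝ) ^ (j + 1)) ^ 2 * (x + 4 * (Real.exp α₀ - 1)) ≤ 1)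
    -- the field: of the class, tangent-critical, over `W`'s datum
    {U : Site d → Fin d → (Matrix n n ℂ)ˣ} (hUu : IsUnitaryCfg U) (hUP : IsPeriodicCfg U ((N * L ^ (j + 1) : ℕ) : ℤ))
    {xU : ℝ} (hxU : 0 ≤ xU) (hsU : LevelSmall d L j xU) (hUxU : SmallField U xU)
    (hcritU : ∀ Y : Site d → Fin d → Matrix n n ℂ, IsSkewDir Y → IsPeriodicDir Y ((N * L ^ (j + 1) : ℕ) : ℤ) →
      dirIter L (j + 1) U Y = 0 → dAction U Y (perWin d (N * L ^ (j + 1))) = 0)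
    (hTopUW : cavgIter L (j + 1) U = cavgIter L (j + 1) W)
    -- row NE3's class data of `W` and E′'s initial gauge ∕ regime (as in `exists_landauRep_W`), the constant `c_RE` named; road (B)'s two extra regime lines
    -- the FLUX-GRADIENT radii of `W` and `U` (row NE3's `RegularSup` datum; (1.8)∕(1.9) TYPE via `NE3FluxGradientDictionary` ∕ `MinimalActionClassSix`)
    {gW gU : ℝ} (hgW : ∀ (z : Site d) (μ : Fin d) (π : T4AveragingDeficitWall.Plane d), ‖T4AveragingDeficitWall.covGrad W (T4AveragingDeficitWall.flux W) z μ π‖ ≤ gW)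
    (hgU : ∀ (z : Site d) (μ : Fin d) (π : T4AveragingDeficitWall.Plane d), ‖T4AveragingDeficitWall.covGrad U (T4AveragingDeficitWall.flux U) z μ π‖ ≤ gU)
    (hbx : 23040 * (d : ℝ) ^ 4 * (frameC d L + d) ^ 2 * ((L : ℝ) ^ (j + 1)) ^ 2 * x ≤ 1)
    (hcx : 11520 * (d : ℝ) ^ 4 * (frameC d L + d) ^ 3 * ((L : ℝ) ^ (j + 1)) ^ 3 * (2 * gW) ≤ 1)
    (hbx' : 256 * (d : ℝ) ^ 2 * ((L : ℝ) ^ (j + 1)) ^ 2 * x ≤ 1) (hcx' : 16 * (d : ℝ) * ((L : ℝ) ^ (j + 1)) ^ 3 * (2 * gW) ≤ 1)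
    {r₀ b₀ : ℝ} (hr₀ : ∀ (y : Site d) (μ : Fin d), ‖(((W y μ)⁻¹ * U y μ : (Matrix n n ℂ)ˣ) : (Matrix n n ℂ)) - 1‖ ≤ r₀)
    (hb₀ : ∀ x : Site d, ‖covDiv W (fun y μ => mlog (((W y μ)⁻¹ * U y μ : (Matrix n n ℂ)ˣ) : (Matrix n n ℂ))) x‖ ≤ b₀)
    {cRE : ℝ} (hcRE : cRE = 1 + 2 * (Fintype.card n : ℝ) * (64 * (d : ℝ) ^ 2 * N) ^ d + 27 * (Fintype.card n : ℝ) ^ 3 * (512 : ℝ) ^ d * (N : ℝ) ^ d)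
    (hreg₁ : (36 * (d : ℝ) * (frameC d L + d) ^ 2) * ((L : ℝ) ^ (j + 1)) ^ 2 * (cRE * b₀) ≤ 1 / 10)
    (hreg₂ : (36 * (d : ℝ) * (frameC d L + d)) * (L : ℝ) ^ (j + 1) * (cRE * b₀) ≤ 1 / 25)
    (hreg₃ : r₀ + 5 / 2 * ((36 * (d : ℝ) * (frameC d L + d)) * (L : ℝ) ^ (j + 1) * (cRE * b₀)) ≤ 1 / 20)
    (hline : cRE * (4 * ((36 * (d : ℝ) * (frameC d L + d) ^ 2) * ((L : ℝ) ^ (j + 1)) ^ 2) * (b₀ + 4 * (cRE * b₀))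
        + 25 * d * (r₀ + 5 / 2 * ((36 * (d : ℝ) * (frameC d L + d)) * (L : ℝ) ^ (j + 1) * (cRE * b₀))) * ((36 * (d : ℝ) * (frameC d L + d)) * (L : ℝ) ^ (j + 1))
        + 14 * d * ((36 * (d : ℝ) * (frameC d L + d)) * (L : ℝ) ^ (j + 1)) ^ 2 * (cRE * b₀)) ≤ 1 / 2)
    -- E′'s radii named: `α_E`, `θ_u`; the tent extension's `δ = corrC∕M·2θ_u`; road (B)'s regime `α_E ≤ 1∕40`, `θ_u ≤ 1∕160`, `δ ≤ 1∕40`, `α₀ ≥ α_E + δ + 4(2θ_u+δ)(α_E+δ)`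
    {αE θu : ℝ} (hαE : αE = 2 * (r₀ + 5 / 2 * ((36 * (d : ℝ) * (frameC d L + d)) * (L : ℝ) ^ (j + 1) * (cRE * b₀))))
    (hθu : θu = 4 * ((36 * (d : ℝ) * (frameC d L + d) ^ 2) * ((L : ℝ) ^ (j + 1)) ^ 2 * (cRE * b₀)))
    (hαE40 : αE ≤ 1 / 40) (hθu160 : θu ≤ 1 / 160)
    {δ : ℝ} (hδ : δ = corrC d / (L : ℝ) ^ (j + 1) * (2 * θu)) (hδ40 : δ ≤ 1 / 40) (hα₀ : αE + δ + 4 * (2 * θu + δ) * (αE + δ) ≤ α₀)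
    -- the remaining analytic letters at `W`: (L1)′ and α₁ for the SAME-TOP structured fields of radius `α₀`, (L2), (L3) discharged
    -- (L1)′ DISCHARGED (F111): the quadratic-remainder regime, the slice `S` containing the `W`-tangent skew periodic fields, and the names `c_N = 4m`, `ν = 24·#Plane·m`
    (hs1 : LevelSmall d L (j + 1) x) (hA : curvSum d L (j + 1) x ≤ 2 / 3 * L) (hσ0 : 4 * (3 + 12 * (d : ℝ)) ^ 2 * (L : ℝ) ^ (j + 1) * α₀ ≤ rho0 d L ^ 2)
    {cN aN dC KG KX KD KΞ ν : ℝ}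
    -- the pointing correction's divergence letter (memo O2: face-supported; displayed until priced), for the TENT extension's structure constants
    (hDivCorr : ∀ (Z : Site d → Fin d → Matrix n n ℂ) (σ : Site d → Matrix n n ℂ) (Z' : Site d → Fin d → Matrix n n ℂ),
      IsSkewDir Z → IsPeriodicDir Z ((N * L ^ (j + 1) : ℕ) : ℤ) → IsLandauB8 (d := d) L N (j + 1) W Z → (∀ y μ, ‖Z y μ‖ ≤ αE) →
      (∀ y, σ y ∈ skewAdjoint (Matrix n n ℂ)) → (∀ (y : Site d) (i : Fin d), σ (y + ((N * L ^ (j + 1) : ℕ) : ℤ) • e i) = σ y) →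
      (∀ y, ‖σ y‖ ≤ 2 * θu) → (∀ (y : Site d) (κ : Fin d), ‖gaugeDir W σ y κ‖ ≤ δ) →
      IsSkewDir Z' → IsPeriodicDir Z' ((N * L ^ (j + 1) : ℕ) : ℤ) →
      (∀ y μ, ‖Z' y μ‖ ≤ α₀) → cavgIter L (j + 1) (vary W Z' 1) = cavgIter L (j + 1) W →
      (∀ (y : Site d) (μ : Fin d), ‖Z' y μ - (Z y μ - gaugeDir W σ y μ)‖ ≤ 4 * (2 * θu + δ) * (αE + δ)) →
      ∀ y : Site d, ‖covDiv W (fun z κ => Z' z κ - (Z z κ - gaugeDir W σ z κ)) y‖ ≤ dC)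
    (haN : aN = (supC d L / ((L : ℝ) ^ (j + 1) * (1 - cruxC d L * (((L : ℝ) ^ (j + 1)) ^ 2 * x)))
        * (4 * (3 + 12 * (d : ℝ)) ^ 3 / rho0 d L ^ 2 * ((L : ℝ) ^ (j + 1) * α₀) ^ 2)))
    (hcN : cN = 4 * (supC d L / ((L : ℝ) ^ (j + 1) * (1 - cruxC d L * (((L : ℝ) ^ (j + 1)) ^ 2 * x)))
        * (4 * (3 + 12 * (d : ℝ)) ^ 3 / rho0 d L ^ 2 * ((L : ℝ) ^ (j + 1) * α₀) ^ 2)))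
    (hνm : ν = 24 * (Fintype.card (T4AveragingDeficitWall.Plane d) : ℝ) * (supC d L / ((L : ℝ) ^ (j + 1) * (1 - cruxC d L * (((L : ℝ) ^ (j + 1)) ^ 2 * x)))
        * (4 * (3 + 12 * (d : ℝ)) ^ 3 / rho0 d L ^ 2 * ((L : ℝ) ^ (j + 1) * α₀) ^ 2)))
    -- THE FOUR-TERM SLICE-SOLVER LETTER (F152's shape) on all skew periodic `W`-tangent fields
    (h4 : ∀ X : Site d → Fin d → Matrix n n ℂ, IsSkewDir X →
      IsPeriodicDir X ((N * L ^ (j + 1) : ℕ) : ℤ) → dirIter L (j + 1) W X = 0 → ∀ R : ℝ, (∀ y κ', ‖X y κ'‖ ≤ R) → ∀ g : ℝ, 0 ≤ g →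
      (∀ Y : Site d → Fin d → Matrix n n ℂ, IsSkewDir Y → IsPeriodicDir Y ((N * L ^ (j + 1) : ℕ) : ℤ) → dirIter L (j + 1) W Y = 0 →
        |hess W X Y (perWin d (N * L ^ (j + 1)))| ≤ g * dirL1 Y (periodBox (d := d) (N * L ^ (j + 1)))) →
      ∀ σ' : Site d → Matrix n n ℂ, (∀ y, σ' y ∈ skewAdjoint (Matrix n n ℂ)) →
      (∀ (y : Site d) (i : Fin d), σ' (y + ((N * L ^ (j + 1) : ℕ) : ℤ) • e i) = σ' y) → ∀ Ξ' : ℝ, (∀ y, ‖σ' y‖ ≤ Ξ') →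
      ∀ D : ℝ, (∀ y, ‖covDiv W (fun z κ => X z κ + gaugeDir W σ' z κ) y‖ ≤ D) →
      ∀ z μ' ν', μ' ≠ ν' → ‖curlAt W X z μ' ν'‖ ≤ KG * g + KX * R + KD * D + KΞ * Ξ')
    (hcritW : ∀ Y : Site d → Fin d → Matrix n n ℂ, IsSkewDir Y → IsPeriodicDir Y ((N * L ^ (j + 1) : ℕ) : ℤ) → dirIter L (j + 1) W Y = 0 →
      dAction W Y (perWin d (N * L ^ (j + 1))) = 0) :
    SmallField U (x + (KG * (
        ((x + 4 * (Real.exp α₀ - 1))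
            * ((curl1C d L / (1 - thetaLoc d L * (((L : ℝ) ^ (j + 1)) ^ 2 * (x + 4 * (Real.exp α₀ - 1)))))
                * (((L : ℝ) ^ (j + 1)) ^ d / ((L : ℝ) ^ (j + 1)) ^ 2))
            * (Real.exp (((L : ℝ) ^ d / L) * ((d : ℝ) * (16 * ((d : ℝ) + 1) * ((d : ℝ) + 4) * (L : ℝ) ^ 2)
                  * (1250 * ((nbRad d L : ℝ) + L) + 8 * ((d : ℝ) * L) + 2 * L)) * (2 / twoLevelSmall d L))
                * ((L : ℝ) / (L : ℝ) ^ d) ^ j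
                * (((d : ℝ) * (2 * nbRad d L + 1) ^ d) * ((2 * (d : ℝ) + 4) * (L : ℝ) ^ 2) * (2 * (L : ℝ) ^ j) * (Real.exp α₀ - 1)
                  + (17 / 8 * ((L : ℝ) ^ 2) ^ j * (x + 4 * (Real.exp α₀ - 1)))
                    * (((d : ℝ) * (2 * nbRad d L + 1) ^ d) * ((2 * (d : ℝ) + 4)
                          * (2 * (2 * L * (nbRad d L : ℝ) + 128 * ((d : ℝ) + 1) * ((d : ℝ) + 4) * (L : ℝ) ^ 2)))
                      + ((d : ℝ) * (2 * nbRad d L + 1) ^ d) * ((2 * (d : ℝ) + 4) * (L : ℝ) ^ 2 * (2 * (nbRad d L : ℝ))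
                          + 2 * (8 * (L : ℝ) + (1250 * ((nbRad d L : ℝ) + L) + 8 * (d * L) + 2 * L))
                              * (16 * ((d : ℝ) + 1) * ((d : ℝ) + 4) * (L : ℝ) ^ 2))))))
        + (Fintype.card (T4AveragingDeficitWall.Plane d) : ℝ)
          * (2 * (240 * (Real.exp α₀ - 1) * α₀ * (2 * ((4 * ((d : ℝ) * αE / ((L ^ (j + 1) : ℕ) : ℝ) + ((L ^ (j + 1) : ℕ) : ℝ) * ((((d : ℝ) - 1) * (2 * gU) + ((d : ℝ) - 1) * (2 * gW) + d * (2 * (Real.exp αE - 1) * xU + 2 * (xU * x) + 2 * (x * (2 + x) * x) + 2 * (xU * (2 + xU) * xU))) + 2 * (b₀ + 3 * (cRE * b₀)))) + (4 * ((L ^ (j + 1) : ℕ) : ℝ) * (8 * d * (Real.exp (4 * αE) - 1) * x + 10 * d * x + 2 * (2 * (d : ℝ) ^ 2 * (((L ^ (j + 1) : ℕ) : ℝ) + 1) * (2 * gW) + 8 * (d : ℝ) ^ 3 * (((L ^ (j + 1) : ℕ) : ℝ) + 1) ^ 2 * x ^ 2) + 12 * d * (2 * (d : ℝ) * (((L ^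 (j + 1) : ℕ) : ℝ) + 1) * x) ^ 2) + 4 * (2 * (d : ℝ) * (((L ^ (j + 1) : ℕ) : ℝ) + 1) * x)) * αE + 2 * x * αE) + 2 * δ + 2 * (4 * (2 * θu + δ) * (αE + δ))) + 24 * α₀ * (Real.exp α₀ - 1) + x) + 8 * α₀ * (2 * ((4 * ((d : ℝ) * αE / ((L ^ (j + 1) : ℕ) : ℝ) + ((L ^ (j + 1) : ℕ) : ℝ) * ((((d : ℝ) - 1) * (2 * gU) + ((d : ℝ) - 1) * (2 * gW) + d * (2 * (Real.exp αE - 1) * xU + 2 * (xU * x) + 2 * (x * (2 + x) * x) + 2 * (xU * (2 + xU) * xU))) + 2 * (b₀ + 3 * (cRE * b₀)))) + (4 * ((L ^ (j + 1) : ℕ) : ℝ) * (8 * d * (Real.exp (4 * αE) - 1) * x + 10 * d * x + 2 * (2 * (d : ℝ) ^ 2 * (((L ^ (j + 1) : ℕ) : ℝ) + 1) * (2 * gW) + 8 * (d : ℝ) ^ 3 * (((L ^ (j + 1) : ℕ) : ℝ) + 1) ^ 2 * x ^ 2) + 12 * d * (2 * (d : ℝ) * (((L ^ (j + 1) : ℕ)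 : ℝ) + 1) * x) ^ 2) + 4 * (2 * (d : ℝ) * (((L ^ (j + 1) : ℕ) : ℝ) + 1) * x)) * αE + 2 * x * αE) + 2 * δ + 2 * (4 * (2 * θu + δ) * (αE + δ))) + 24 * α₀ * (Real.exp α₀ - 1))
              + 6 * (Real.exp α₀ - 1) * (2 * ((4 * ((d : ℝ) * αE / ((L ^ (j + 1) : ℕ) : ℝ) + ((L ^ (j + 1) : ℕ) : ℝ) * ((((d : ℝ) - 1) * (2 * gU) + ((d : ℝ) - 1) * (2 * gW) + d * (2 * (Real.exp αE - 1) * xU + 2 * (xU * x) + 2 * (x * (2 + x) * x) + 2 * (xU * (2 + xU) * xU))) + 2 * (b₀ + 3 * (cRE * b₀)))) + (4 * ((L ^ (j + 1) : ℕ) : ℝ) * (8 * d * (Real.exp (4 * αE) - 1) * x + 10 * d * x + 2 * (2 * (d : ℝ) ^ 2 * (((L ^ (j + 1) : ℕ) : ℝ) + 1) * (2 * gW) + 8 * (d : ℝ) ^ 3 * (((L ^ (j + 1) : ℕ) : ℝ) + 1) ^ 2 * x ^ 2) + 12 * d * (2 * (d : ℝ) * (((L ^ (j + 1) : ℕ)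 : ℝ) + 1) * x) ^ 2) + 4 * (2 * (d : ℝ) * (((L ^ (j + 1) : ℕ) : ℝ) + 1) * x)) * αE + 2 * x * αE) + 2 * δ + 2 * (4 * (2 * θu + δ) * (αE + δ))) + 24 * (Real.exp α₀ - 1) * α₀)
              + (2 * ((4 * ((d : ℝ) * αE / ((L ^ (j + 1) : ℕ) : ℝ) + ((L ^ (j + 1) : ℕ) : ℝ) * ((((d : ℝ) - 1) * (2 * gU) + ((d : ℝ) - 1) * (2 * gW) + d * (2 * (Real.exp αE - 1) * xU + 2 * (xU * x) + 2 * (x * (2 + x) * x) + 2 * (xU * (2 + xU) * xU))) + 2 * (b₀ + 3 * (cRE * b₀)))) + (4 * ((L ^ (j + 1) : ℕ) : ℝ) * (8 * d * (Real.exp (4 * αE) - 1) * x + 10 * d * x + 2 * (2 * (d : ℝ) ^ 2 * (((L ^ (j + 1) : ℕ) : ℝ) + 1) * (2 * gW) + 8 * (d : ℝ) ^ 3 * (((L ^ (j + 1) : ℕ) : ℝ) + 1) ^ 2 * x ^ 2) + 12 * d * (2 * (d : ℝ) * (((L ^ (j + 1) : ℕ) : ℝ) + 1) * x) ^ 2)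 + 4 * (2 * (d : ℝ) * (((L ^ (j + 1) : ℕ) : ℝ) + 1) * x)) * αE + 2 * x * αE) + 2 * δ + 2 * (4 * (2 * θu + δ) * (αE + δ))) + 24 * (Real.exp α₀ - 1) * α₀) * (2 * ((4 * ((d : ℝ) * αE / ((L ^ (j + 1) : ℕ) : ℝ) + ((L ^ (j + 1) : ℕ) : ℝ) * ((((d : ℝ) - 1) * (2 * gU) + ((d : ℝ) - 1) * (2 * gW) + d * (2 * (Real.exp αE - 1) * xU + 2 * (xU * x) + 2 * (x * (2 + x) * x) + 2 * (xU * (2 + xU) * xU))) + 2 * (b₀ + 3 * (cRE * b₀)))) + (4 * ((L ^ (j + 1) : ℕ) : ℝ) * (8 * d * (Real.exp (4 * αE) - 1) * x + 10 * d * x + 2 * (2 * (d : ℝ) ^ 2 * (((L ^ (j + 1) : ℕ) : ℝ) + 1) * (2 * gW) + 8 * (d : ℝ) ^ 3 * (((L ^ (j + 1) : ℕ) : ℝ) + 1) ^ 2 * x ^ 2) + 12 * d * (2 * (d : ℝ) * (((L ^ (j + 1) : ℕ) : ℝ) + 1) * x) ^ 2) + 4 * (2 * (d : ℝ) * (((L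 ^ (j + 1) : ℕ) : ℝ) + 1) * x)) * αE + 2 * x * αE) + 2 * δ + 2 * (4 * (2 * θu + δ) * (αE + δ))) + 24 * α₀ * (Real.exp α₀ - 1))
              + 960 * (Real.exp α₀ - 1) * α₀ ^ 2 + 32 * x * α₀ ^ 2)
            + (64 * α₀ * ((4 * ((d : ℝ) * αE / ((L ^ (j + 1) : ℕ) : ℝ) + ((L ^ (j + 1) : ℕ) : ℝ) * ((((d : ℝ) - 1) * (2 * gU) + ((d : ℝ) - 1) * (2 * gW) + d * (2 * (Real.exp αE - 1) * xU + 2 * (xU * x) + 2 * (x * (2 + x) * x) + 2 * (xU * (2 + xU) * xU))) + 2 * (b₀ + 3 * (cRE * b₀)))) + (4 * ((L ^ (j + 1) : ℕ) : ℝ) * (8 * d * (Real.exp (4 * αE) - 1) * x + 10 * d * x + 2 * (2 * (d : ℝ) ^ 2 * (((L ^ (j + 1) : ℕ) : ℝ) + 1) * (2 * gW) + 8 * (d : ℝ) ^ 3 * (((L ^ (j + 1) : ℕ) : ℝ) + 1) ^ 2 * x ^ 2) + 12 * d * (2 * (d : ℝ) * (((L ^ (j + 1) : ℕ) : ℝ)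 + 1) * x) ^ 2) + 4 * (2 * (d : ℝ) * (((L ^ (j + 1) : ℕ) : ℝ) + 1) * x)) * αE + 2 * x * αE) + 2 * δ + 2 * (4 * (2 * θu + δ) * (αE + δ))) + 1024 * x * α₀ ^ 2))
        + ν) + KX * (α₀ + aN) + KD * (dC + (b₀ + 3 * (cRE * b₀)) + 2 * (d : ℝ) * aN) + KΞ * (2 * θu) + cN + 28 * α₀ ^ 2)) := by
  have hx4 : x ≤ 1 / 4 := by
    have hM : (1 : ℝ) ≤ ((L : ℝ) ^ (j + 1)) ^ 2 := one_le_pow₀ (one_le_pow₀ (by exact_mod_cast (by omega : 1 ≤ L)))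
    have hd2 : (4 : ℝ) ≤ (d : ℝ) ^ 2 := by
      have hd' : (2 : ℝ) ≤ d := by exact_mod_cast hd
      nlinarith only [hd']
    have h4 : (4 : ℝ) ≤ 256 * (d : ℝ) ^ 2 * ((L : ℝ) ^ (j + 1)) ^ 2 := by nlinarith only [hd2, hM]
    have h3 : 4 * x ≤ 256 * (d : ℝ) ^ 2 * ((L : ℝ) ^ (j + 1)) ^ 2 * x := mul_le_mul_of_nonneg_right h4 hx
    linarith only [h3, hbx']
  have hxU4 : xU ≤ 1 / 4 := by
    have hT : (4 : ℝ) ≤ twoLevelSmall d L := by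
      unfold AveragingDeficitTwoLevelPrep.twoLevelSmall
      have h1 : (1 : ℝ) ≤ ((d : ℝ) + 1) ^ 2 := one_le_pow₀ (by linarith [(Nat.cast_nonneg d : (0 : ℝ) ≤ d)])
      have h2 : (1 : ℝ) ≤ ((d : ℝ) + 4) ^ 2 := one_le_pow₀ (by linarith [(Nat.cast_nonneg d : (0 : ℝ) ≤ d)])
      have h3 : (1 : ℝ) ≤ (L : ℝ) ^ (d + 4) := one_le_pow₀ (by exact_mod_cast (by omega : 1 ≤ L))
      have h123 := one_le_mul_of_one_le_of_one_le (one_le_mul_of_one_le_of_one_le h1 h2) h3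
      have h4 : 65536 * ((d : ℝ) + 1) ^ 2 * ((d : ℝ) + 4) ^ 2 * (L : ℝ) ^ (d + 4) = 65536 * (((d : ℝ) + 1) ^ 2 * ((d : ℝ) + 4) ^ 2 * (L : ℝ) ^ (d + 4)) := by ring
      rw [h4]
      linarith
    have h5 := mul_le_mul_of_nonneg_right hT hxU
    linarith [hsU.two]
  have hgW0 : 0 ≤ gW := (norm_nonneg _).trans (hgW 0 ⟨0, by omega⟩ ⟨(⟨0, by omega⟩, ⟨1, by omega⟩), by simp⟩)
  have hgrad : ∀ (p : Site d) (μ κ : Fin d), κ ≠ μ →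
      ‖Ad (W p μ) ((hol W (p + e μ) (plaqWord κ μ) : (Matrix n n ℂ)ˣ) : Matrix n n ℂ) - ((hol W p (plaqWord κ μ) : (Matrix n n ℂ)ˣ) : Matrix n n ℂ)‖ ≤ 2 * gW :=
    fun p μ κ hκμ => norm_Ad_hol_sub_hol_le_of_fluxGrad hWu hWx hx4 hgW p μ hκμ
  have hjU : ∀ (ν : Fin d) (y : Site d), ‖B8Ineq132.covDiv 1 U ν y‖ ≤ ((d : ℝ) - 1) * (2 * gU) := fun ν y =>
    (norm_covDiv_le_of_covGrad 1 hUu hUxU hxU4 hgU y ν).trans (by rw [abs_one, inv_one, one_mul])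
  have hjW : ∀ (ν : Fin d) (y : Site d), ‖B8Ineq132.covDiv 1 W ν y‖ ≤ ((d : ℝ) - 1) * (2 * gW) := fun ν y =>
    (norm_covDiv_le_of_covGrad 1 hWu hWx hx4 hgW y ν).trans (by rw [abs_one, inv_one, one_mul])
  exact smallField_of_tanCritical_roadB_gradientM_fourTerm hd hL j hWu hWP hx hs hWx hα0 hs' hθ hθl hε hUu hUP hxU hsU hUxU hcritU hTopUW (by positivity) hgrad hbx hcx hbx' hcx'
    hr₀ hb₀ hcRE hreg₁ hreg₂ hreg₃ hline hαE hθu hαE40 hθu160 hδ hδ40 hα₀ hs1 hA hσ0 hDivCorr haN hcN hνm hjU hjW h4 hcritW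

end

end Summit.QuantumFields.BalabanUV.T4Continuum.NE7ApeCurvedRepRoadBGradientClassFourTerm
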